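import Summits.ResolutionOfSingularities.ResolutionOfSingularities.Theorems.EquisingularLiftEquisingularLiftNatTowerConeRound
import Summits.ResolutionOfSingularities.ResolutionOfSingularities.Theorems.EquisingularLiftEquisingularLiftNatTowerCurveStepCartier
import Summits.ResolutionOfSingularities.ResolutionOfSingularities.Theorems.EquisingularLiftEquisingularLiftNatTowerRuledRootsSec
import Summits.ResolutionOfSingularities.ResolutionOfSingularities.Theorems.EquisingularLiftEquisingularLiftNatCentreOffGeneric
import Summits.ResolutionOfSingularities.ResolutionOfSingularities.Theorems.EquisingularLiftEquisingularLiftNatRationalCarrierLift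
import HarnessLib

/-!
# [OURS · L1 W4.5(b) · EL♮(3)] DISCHARGING THE ROOT STAND-INS S1 `hRootCurve` / S2 `hRootRound` OF THE TOWER₃/₄ ASSEMBLY, MODULO THE TWO
# OWNED INPUTS (c) «2-frames» and (d) «conditional rationality» — corollaries of res-D-pv-029's bricks, NO brick body copied

Crux chain w45b (cell `res-hironaka`, slot W4.5(b)), working crux **EL♮** = stmt-ResolutionOfSingularities-20038, child **EL♮(3)** =
stmt-ResolutionOfSingularities-20148, route EquisingularLift, line `sections`; registered stub `stub_elnat_coneTowerPointResolution` (CHILD v20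
b3765926fa2d2fc5; `₄` = «all rounds along sections» per res-L1-w45b-plan-1 RULING-8 2026-08-27T20:28:31Z, text res-L1-w45b-lead-2
…NatTowerRoundThreeDefs). Written by res-L1-w45b-stub-4 g8 (TOWER₃ assembly inputs (e)/(b); TAKING 20:34:19Z). HONEST FRAMING: OURS; NOT a
statement of any manuscript; AI-written, weaker than expert review. No `sorry`; standard axioms; DEF-FREE; pure logic over landed bricks.
`--supports stmt-ResolutionOfSingularities-20148 --as helper`.

CONTEXT. res-D-pv-029's assembly skeleton `hsub_reachTower_three_of` (mirror `D/res-D-pv-029/gen8/TowerAssembly.lean` v3) carries the stand-ins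
  S1 `hRootCurve` (fed to `Tower.inv₂_of_invKC_curveStep` / `Tower.inv₂_of_inv_curveStep_forget`, …NatTowerCurveStepCartier p558664) and
  S2 `hRootRound` (fed to `Tower.inv₂_coneRound_new`, …NatTowerConeRound p558403),
whose conclusions are res-L1-w45b-stub-2's roots `DirLift.ruled_curveStep_root` / `ruled_round_root` (…NatTowerRuledRoots p562947) but whose
binder lists LACK the roots' inputs (a) `hυ'`/`hυ₂`, (b) `hCoff`, (c) `hCframe`, (d) `hCrat`, (e) `δ hδ [IsIso δ]` (binder text of record
`L/res-L1-w45b-stub-2/ROOTS-INPUTS.sig.txt` 978abd3aff7daeaa). THIS FILE removes S1/S2 in favour of two stand-ins that ARE owned and dischargeable: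
* (a) is outer context of the bricks; (e) is outer context under `₄` (`hsec : DirStepSec …`, res-L1-w45b-stub-4 …NatTowerRuledRootsSec p567376);
* (b) is PROVED inside the stand-in's lambda from its own binders (`Ch X σ S`, model square, `jG '' T = S`, exact trace) and the outer bookkeeping
  (`¬ T₉ ⊆ Z₉` at the curve step; `Z ⊆ E`, `¬ T ⊆ E` at a round) by `image_support_subset_not_isGenericPoint_of_chain` (…NatCentreOffGeneric);
* (c) becomes the stand-in `hFrame` «quasi-regular 2-frames of every regular `O`-flat centre with exact reduced trace `𝓘⟨Z⟩` on a `Ch`-stage with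
  model square `jG`, `jG '' T = S`» — discharged by res-L1-w45b-stub-3's `forall_exists_twoFrame_of_isRegular` (p564791) from `hcodim`, itself
  res-L1-w45b-stub-3 g7's (β) T-DIM-CENTRE (+ res-D-brk-4's (ii) p566652 for route C);
* (d) becomes res-L1-type-o6's ONE assembly binder `hTj : RationalCarrierLift O k θ P q` (residue (T-j), …NatRationalCarrierLift p568626 ✓:
  `RationalCarrierLift.hCrat_of_isProper`, properness of the stage from `chain_isRegular`); at a round the carrier's certificate `RationalCarrier Z̃₉`
  is moved to the centre's trace `Z̃` along the section isomorphism (`rationalCarrier_of_dirStepSec`).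
RESULTS: `Tower.inv₂_coneRound_new_sec` (S2 gone: cone round of `TowerRound₃`, i.e. WITH `hsec`; `TowerFull` derived), `Tower.inv₂_of_invKC_curveStep_sec`
and `Tower.inv₂_of_inv_curveStep_forget_sec` (S1 gone), all at `Ruled := DirLift.Ruled O k θ P q Y`, each ONE application of the corresponding brick,
modulo the ONE stand-in `hFrame` (input (c)) and the residue binder `hTj` (input (d)).
ASSEMBLY EDIT for res-D-pv-029 (two lines per call site): replace `(hRootCurve T₉ Z₉ hZ₉ υ')` / `(hRootRound Z₉ hZ₉ υ' G G' γ T Z hZ υ₂)` by the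
`_sec` bricks with `hYsp`, `hsec` (from `TowerRound₃`'s hoisted clause), `hTj`, and the new binder `hFrameAll : ∀ {G} (T Z : Set G) (hZ), …`
quantified over the stage.

References (index only): res-D-pv-029 p558403 / p558664 / p556392 (…NatTowerInvDefs); res-L1-w45b-stub-2 p561677 / p562947; res-L1-w45b-stub-3
p564791; res-L1-type-o6 …NatRationalCarrierLift p568626; res-L1-w45b-lead-2 …NatTowerRoundThreeDefs (`TowerRound₃`).
-/

set_option linter.dupNamespace false -- mandated namespace `Summit.<Summit>.<Problem>` of this single-conjunct summit
set_option linter.overlappingInstances false -- signatures carry `[IsDomain O] [IsDiscreteValuationRing O]`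

noncomputable section

open CategoryTheory CategoryTheory.Limits AlgebraicGeometry TopologicalSpace Topology IsLocalRing
open Literature.AlgebraicGeometry.Resolution
open Literature.AlgebraicGeometry.Morphisms (ProjCech.PP ProjCech.toSpec)
open AlgebraicGeometry.Scheme.IdealSheafData
open Summit.ResolutionOfSingularities.ResolutionOfSingularities.Theses.EquisingularLift.Split
open Summit.ResolutionOfSingularities.ResolutionOfSingularities.Cruxes.EquisingularLift.StrataSplit

namespace Summit.ResolutionOfSingularities.ResolutionOfSingularities.Cruxes.EquisingularLiftNat.Sections

/-! ## Moving the rationality certificate along an isomorphism -/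

/-- `RationalCarrier` is invariant under isomorphism. [OURS · pure logic] -/
theorem rationalCarrier_of_iso {C C' : Scheme.{0}} (e : C ≅ C') (h : RationalCarrier C') : RationalCarrier C := by
  obtain ⟨k', hk', ⟨e'⟩⟩ := h
  exact ⟨k', hk', ⟨e ≪≫ e'⟩⟩

/-- Along a section (`DirStepSec`: `Z̃ ≅ Z̃₉`) the carrier's rationality certificate moves to the centre's trace. [OURS · pure logic] -/
theorem rationalCarrier_of_dirStepSec {F₉ F₁₀ : Scheme.{0}} {υ' : F₁₀ ⟶ F₉} {Z₉ : Set F₉} {hZ₉ : IsClosed Z₉}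
    {G : Scheme.{0}} {γ : G ⟶ F₁₀} {Z : Set G} {hZ : IsClosed Z} (hsec : DirStepSec F₉ F₁₀ υ' Z₉ hZ₉ G γ Z hZ)
    (h : RationalCarrier (redSub F₉ Z₉ hZ₉)) : RationalCarrier (redSub G Z hZ) := by
  obtain ⟨δ, -, hiso⟩ := hsec
  exact rationalCarrier_of_iso (asIso δ) h

/-! ## S2 discharged: the cone-witnessed round ALONG A SECTION (`TowerRound₃`), new exceptional surface -/

set_option maxHeartbeats 400000 in -- one application of a 40-binder brick with a 25-binder lambda
/-- **THE CONE-WITNESSED ROUND on `Tower.Inv₂` at `Ruled := DirLift.Ruled`, new exceptional surface, WITHOUT the root stand-in S2** (see the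
module docstring): res-D-pv-029's `Tower.inv₂_coneRound_new` with `hRuled` supplied by `DirLift.ruled_coneRound_root_of_dirStepSec` — inputs
(a) `hυ₂` and (e) `hsec` from the round, (b) from the chain (`image_support_subset_not_isGenericPoint_of_chain_of_subset`), (c) the OWNED stand-in
`hFrame` (stub-3 currency), (d) the residue binder `hTj : RationalCarrierLift O k θ P q` (o6). `TowerFull` is derived from `hsec`. [cite: GortzWedhorn2020, (13.19) and Prop. 13.91]
[cite: Liu2002, Thm. 8.1.19] [OURS · L1 W4.5b · pure logic over p558403 / p567376 / …NatCentreOffGeneric] clause (round, cone) of the TOWER₄ driver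
toward `stub_elnat_coneTowerPointResolution` (stmt-ResolutionOfSingularities-20148 / -20038); NOT a statement of the manuscript. -/
theorem Tower.inv₂_coneRound_new_sec (O : Type) [CommRing O] [IsDomain O] [IsDiscreteValuationRing O] (k : Type) [Field k]
    (θ : O →+* k) (hθ : Function.Surjective θ)
    (P : Scheme.{0}) (q : P ⟶ Spec (.of O)) [IsProper q] (Y : Set P) (hYsp : Y ⊆ q ⁻¹' {closedPoint O})
    (hYirr : IsIrreducible Y) (hYcl : IsClosed Y) (hPnoeth : IsLocallyNoetherian P) (hPreg : Scheme.IsRegular P)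
    (Ch : ∀ X' : Scheme.{0}, (X' ⟶ P) → Set X' → Prop)
    (hChain : ∀ (X' : Scheme.{0}) (σ : X' ⟶ P) (S : Set X'), Ch X' σ S → Chain P Y X' σ S)
    (hStep : ∀ (X' X'' : Scheme.{0}) (σ' : X' ⟶ P) (S' : Set X') (C : X'.IdealSheafData) (τ : X'' ⟶ X'),
      Ch X' σ' S' → IsBlowup τ C → Scheme.IsRegular C.subscheme → Flat (C.subschemeι ≫ σ' ≫ q) →
      σ' '' (C.support : Set X') ⊆ {x : P | ¬ IsGenericPoint x Y} →
      (C.support : Set X') ∩ (σ' ≫ q) ⁻¹' {IsLocalRing.closedPoint O} ⊆ S' →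
      Ch X'' (τ ≫ σ') (closure (τ ⁻¹' (S' \ (C.support : Set X')))))
    {F₉ : Scheme.{0}} (Z₉ : Set F₉) (hZ₉ : IsClosed Z₉) {F₁₀ : Scheme.{0}} (υ' : F₁₀ ⟶ F₉)
    (G G' : Scheme.{0}) (γ : G ⟶ F₁₀) (T E K : Set G) (hE : IsClosed E) (Z : Set G) (hZ : IsClosed Z) (υ₂ : G' ⟶ G)
    (hinv : Tower.Inv₂ O k θ P q Y Ch (DirLift.Ruled O k θ P q Y) F₉ Z₉ hZ₉ F₁₀ υ' G γ T E K)
    (hZET : Z ⊆ E ∩ T) (hZne : Z.Nonempty) (hsec : DirStepSec F₉ F₁₀ υ' Z₉ hZ₉ G γ Z hZ) (hcone : ConeWitness G E hE K Z hZ)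
    (hυ₂ : IsBlowup υ₂ (vanishingIdeal ⟨Z, hZ⟩))
    -- the assembly's downstairs side facts carried next to `Tower.Inv₂`
    (hKcl : IsClosed K) (hKE : K ⊆ closure (K \ E)) (hKne : K ≠ Set.univ)
    -- STAND-IN (c), owner res-L1-w45b-stub-3 (p564791 + (β) T-DIM-CENTRE): quasi-regular 2-frames of a regular `O`-flat centre with trace `𝓘⟨Z⟩`
    (hFrame : ∀ (X : Scheme.{0}) (σ : X ⟶ P) (S : Set X) (jG : G ⟶ X) (tG : G ⟶ Spec (.of k)) (𝒞 : X.IdealSheafData),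
      Ch X σ S → IsIntegral X → IsLocallyNoetherian X → Scheme.IsRegular X → IsDominant (σ ≫ q) →
      IsPullback jG tG (σ ≫ q) (Spec.map (CommRingCat.ofHom θ)) → jG '' T = S →
      𝒞.comap jG = vanishingIdeal ⟨Z, hZ⟩ → Flat (𝒞.subschemeι ≫ σ ≫ q) → Scheme.IsRegular 𝒞.subscheme →
      ∀ x ∈ 𝒞.support, ∃ c : Fin 2 → X.presheaf.stalk x, Ideal.span (Set.range c) = stalkIdeal 𝒞 x ∧ IsQuasiRegular c)
    -- RESIDUE (d) = (T-j), owner res-L1-type-o6 (…NatRationalCarrierLift): conditional upstairs rationality of regular `O`-flat centres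
    (hTj : RationalCarrierLift O k θ P q)
    (K' : Set G') (hK' : K' = ∅ ∨ K' = closure (υ₂ ⁻¹' (K \ Z))) :
    Tower.Inv₂ O k θ P q Y Ch (DirLift.Ruled O k θ P q Y) F₉ Z₉ hZ₉ F₁₀ υ' G' (υ₂ ≫ γ) (closure (υ₂ ⁻¹' (T \ Z)))
      (υ₂ ⁻¹' Z) K' := by
  have hZE : Z ⊆ E := fun z hz => (hZET hz).1
  have hTE : ¬ T ⊆ E := hinv.2.2.2.2.2.2.1
  exact Tower.inv₂_coneRound_new O k θ hθ P q Y hYirr hYcl hPnoeth hPreg Ch hChain hStep (DirLift.Ruled O k θ P q Y) Z₉ hZ₉ υ' G G'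
    γ T E K hE Z hZ υ₂ hinv hZET hZne (towerFull_of_dirStepSec hsec) hcone hυ₂ hKcl hKE hKne
    (fun X σ S jG tG 𝓔 𝒦 X'' τ j₂ t₂ hCh hXint hXnoeth hXreg hdom hsq hTS hCD hCflat hCreg _ hτ hsq₂ hcomm => by
      haveI := hXint
      haveI := hXnoeth
      exact DirLift.ruled_coneRound_root_of_dirStepSec G G' γ T Z hZ υ₂ X σ S jG tG 𝓔 𝒦 X'' τ j₂ t₂ hXreg hsq hTS hCD hCflat
        hCreg hτ hsq₂ hcomm hυ₂ hsec
        (image_support_subset_not_isGenericPoint_of_chain_of_subset θ hθ q Y hYsp σ S (hChain _ _ _ hCh) jG tG hsq T hTS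
          (𝓔 ⊔ 𝒦) Z hZ hCD E hZE hTE)
        (hFrame X σ S jG tG (𝓔 ⊔ 𝒦) hCh hXint hXnoeth hXreg hdom hsq hTS hCD hCflat hCreg)
        (fun h₉ => by
          haveI : IsProper σ := (chain_isRegular P Y X σ S (hChain _ _ _ hCh) hPnoeth hPreg).2.2
          exact hTj.hCrat_of_isProper σ (𝓔 ⊔ 𝒦) hsq hCD hCflat hCreg (rationalCarrier_of_dirStepSec hsec h₉)))
    K' hK'

/-! ## S1 discharged: the curve step (shadow kept / shadow forgotten) -/

set_option maxHeartbeats 400000 in -- one application of a 40-binder brick with a 25-binder lambda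
/-- **THE CURVE STEP on `Tower.Inv₂` at `Ruled := DirLift.Ruled`, shadow KEPT (`TCPlus.InvKC`), WITHOUT the root stand-in S1** (see the module
docstring): res-D-pv-029's `Tower.inv₂_of_invKC_curveStep` with `hRuled` supplied by res-L1-w45b-stub-2's `DirLift.ruled_curveStep_root` —
(a) `hυ'` from the step, (b) from the chain (`image_support_subset_not_isGenericPoint_of_chain` with `¬ T₉ ⊆ Z₉`), (c) the OWNED stand-in
`hFrame`, (d) the residue binder `hTj` (here the centre's trace IS the carrier `Z₉`). [cite: GortzWedhorn2020, (13.19) and Prop. 13.91] [cite: Liu2002, Thm. 8.1.19]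
[OURS · L1 W4.5b · pure logic over p558664 / p562947 / …NatCentreOffGeneric] clause (curve) of the TOWER₄ driver toward
`stub_elnat_coneTowerPointResolution` (stmt-ResolutionOfSingularities-20148 / -20038); NOT a statement of the manuscript. -/
theorem Tower.inv₂_of_invKC_curveStep_sec (O : Type) [CommRing O] [IsDomain O] [IsDiscreteValuationRing O] (k : Type) [Field k]
    (θ : O →+* k) (hθ : Function.Surjective θ)
    (P : Scheme.{0}) (q : P ⟶ Spec (.of O)) [IsProper q] (Y : Set P) (hYsp : Y ⊆ q ⁻¹' {closedPoint O})
    (hYirr : IsIrreducible Y) (hYcl : IsClosed Y) (hPnoeth : IsLocallyNoetherian P) (hPreg : Scheme.IsRegular P)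
    (Ch : ∀ X' : Scheme.{0}, (X' ⟶ P) → Set X' → Prop)
    (hChain : ∀ (X' : Scheme.{0}) (σ : X' ⟶ P) (S : Set X'), Ch X' σ S → Chain P Y X' σ S)
    (hStep : ∀ (X' X'' : Scheme.{0}) (σ' : X' ⟶ P) (S' : Set X') (C : X'.IdealSheafData) (τ : X'' ⟶ X'),
      Ch X' σ' S' → IsBlowup τ C → Scheme.IsRegular C.subscheme → Flat (C.subschemeι ≫ σ' ≫ q) →
      σ' '' (C.support : Set X') ⊆ {x : P | ¬ IsGenericPoint x Y} →
      (C.support : Set X') ∩ (σ' ≫ q) ⁻¹' {IsLocalRing.closedPoint O} ⊆ S' →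
      Ch X'' (τ ≫ σ') (closure (τ ⁻¹' (S' \ (C.support : Set X')))))
    {F₁ F₂ : Scheme.{0}} (W : Set F₁) (F₉ : Scheme.{0}) (β₉ : F₉ ⟶ F₂) (T₉ Z₉ K₉ : Set F₉) (b₉ : Bool) (hZ₉ : IsClosed Z₉)
    (F₁₀ : Scheme.{0}) (υ' : F₁₀ ⟶ F₉)
    (hI : TCPlus.InvKC O k θ P q Y Ch W F₉ β₉ T₉ Z₉ K₉ b₉) (hZinf : Z₉.Infinite) (hKcl : IsClosed K₉) (hKne : K₉ ≠ Set.univ)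
    (hKdense : K₉ ⊆ closure (K₉ \ Z₉))
    (hZT : Z₉ ⊆ T₉) (hTZ : ¬ T₉ ⊆ Z₉) (hυ' : IsBlowup υ' (vanishingIdeal ⟨Z₉, hZ₉⟩))
    -- STAND-IN (c), owner res-L1-w45b-stub-3: quasi-regular 2-frames of a regular `O`-flat centre with trace `𝓘⟨Z₉⟩` on the carrier stage
    (hFrame : ∀ (X : Scheme.{0}) (σ : X ⟶ P) (S : Set X) (jG : F₉ ⟶ X) (tG : F₉ ⟶ Spec (.of k)) (𝒞 : X.IdealSheafData),
      Ch X σ S → IsIntegral X → IsLocallyNoetherian X → Scheme.IsRegular X → IsDominant (σ ≫ q) →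
      IsPullback jG tG (σ ≫ q) (Spec.map (CommRingCat.ofHom θ)) → jG '' T₉ = S →
      𝒞.comap jG = vanishingIdeal ⟨Z₉, hZ₉⟩ → Flat (𝒞.subschemeι ≫ σ ≫ q) → Scheme.IsRegular 𝒞.subscheme →
      ∀ x ∈ 𝒞.support, ∃ c : Fin 2 → X.presheaf.stalk x, Ideal.span (Set.range c) = stalkIdeal 𝒞 x ∧ IsQuasiRegular c)
    -- RESIDUE (d) = (T-j), owner res-L1-type-o6 (…NatRationalCarrierLift): conditional upstairs rationality of regular `O`-flat centres
    (hTj : RationalCarrierLift O k θ P q) :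
    Tower.Inv₂ O k θ P q Y Ch (DirLift.Ruled O k θ P q Y) F₉ Z₉ hZ₉ F₁₀ υ' F₁₀ (𝟙 F₁₀) (closure (υ' ⁻¹' (T₉ \ Z₉))) (υ' ⁻¹' Z₉)
      (closure (υ' ⁻¹' (K₉ \ Z₉))) :=
  Tower.inv₂_of_invKC_curveStep O k θ hθ P q Y hYirr hYcl hPnoeth hPreg Ch hChain hStep (DirLift.Ruled O k θ P q Y) W F₉ β₉ T₉ Z₉ K₉
    b₉ hZ₉ F₁₀ υ' hI hZinf hKcl hKne hKdense hZT hTZ hυ'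
    (fun X σ S jG tG 𝓢 K X₁₀ τ j₁₀ t₁₀ hCh hXint hXnoeth hXreg hdom hsq hTS hCD hCflat hCreg _ hτ hsq₁₀ hcomm => by
      haveI := hXint
      haveI := hXnoeth
      exact DirLift.ruled_curveStep_root hυ' X σ jG tG (𝓢 ⊔ K) X₁₀ τ j₁₀ t₁₀ hXreg hsq hCD hCflat hCreg hτ hsq₁₀ hcomm
        (image_support_subset_not_isGenericPoint_of_chain θ hθ q Y hYsp σ S (hChain _ _ _ hCh) jG tG hsq T₉ hTS (𝓢 ⊔ K) Z₉ hZ₉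
          hCD hTZ)
        (hFrame X σ S jG tG (𝓢 ⊔ K) hCh hXint hXnoeth hXreg hdom hsq hTS hCD hCflat hCreg)
        (fun h₉ => by
          haveI : IsProper σ := (chain_isRegular P Y X σ S (hChain _ _ _ hCh) hPnoeth hPreg).2.2
          exact hTj.hCrat_of_isProper σ (𝓢 ⊔ K) hsq hCD hCflat hCreg h₉))

set_option maxHeartbeats 400000 in -- one application of a 40-binder brick with a 25-binder lambda
/-- **THE CURVE STEP on `Tower.Inv₂` at `Ruled := DirLift.Ruled`, shadow FORGOTTEN (`TCPlus.Inv`, `K₉ = ∅`), WITHOUT the root stand-in S1**: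
res-D-pv-029's `Tower.inv₂_of_inv_curveStep_forget` with `hRuled` supplied as in `Tower.inv₂_of_invKC_curveStep_sec`.
[cite: GortzWedhorn2020, (13.19) and Prop. 13.91] [cite: Liu2002, Thm. 8.1.19] [OURS · L1 W4.5b · pure logic over p558664 / p562947 /
…NatCentreOffGeneric] clause (curve, γ-forget) of the TOWER₄ driver toward `stub_elnat_coneTowerPointResolution`
(stmt-ResolutionOfSingularities-20148 / -20038); NOT a statement of the manuscript. -/
theorem Tower.inv₂_of_inv_curveStep_forget_sec (O : Type) [CommRing O] [IsDomain O] [IsDiscreteValuationRing O] (k : Type) [Field k]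
    (θ : O →+* k) (hθ : Function.Surjective θ)
    (P : Scheme.{0}) (q : P ⟶ Spec (.of O)) [IsProper q] (Y : Set P) (hYsp : Y ⊆ q ⁻¹' {closedPoint O})
    (hYirr : IsIrreducible Y) (hYcl : IsClosed Y) (hPnoeth : IsLocallyNoetherian P) (hPreg : Scheme.IsRegular P)
    (Ch : ∀ X' : Scheme.{0}, (X' ⟶ P) → Set X' → Prop)
    (hChain : ∀ (X' : Scheme.{0}) (σ : X' ⟶ P) (S : Set X'), Ch X' σ S → Chain P Y X' σ S)
    (hStep : ∀ (X' X'' : Scheme.{0}) (σ' : X' ⟶ P) (S' : Set X') (C : X'.IdealSheafData) (τ : X'' ⟶ X'),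
      Ch X' σ' S' → IsBlowup τ C → Scheme.IsRegular C.subscheme → Flat (C.subschemeι ≫ σ' ≫ q) →
      σ' '' (C.support : Set X') ⊆ {x : P | ¬ IsGenericPoint x Y} →
      (C.support : Set X') ∩ (σ' ≫ q) ⁻¹' {IsLocalRing.closedPoint O} ⊆ S' →
      Ch X'' (τ ≫ σ') (closure (τ ⁻¹' (S' \ (C.support : Set X')))))
    {F₁ F₂ : Scheme.{0}} (W : Set F₁) (F₉ : Scheme.{0}) (β₉ : F₉ ⟶ F₂) (T₉ Z₉ K₉ : Set F₉) (b₉ : Bool) (hZ₉ : IsClosed Z₉)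
    (F₁₀ : Scheme.{0}) (υ' : F₁₀ ⟶ F₉)
    (hI : TCPlus.Inv O k θ P q Y Ch W F₉ β₉ T₉ Z₉ b₉) (hZinf : Z₉.Infinite) (hK₉ : K₉ = ∅)
    (hZT : Z₉ ⊆ T₉) (hTZ : ¬ T₉ ⊆ Z₉) (hυ' : IsBlowup υ' (vanishingIdeal ⟨Z₉, hZ₉⟩))
    -- STAND-IN (c), owner res-L1-w45b-stub-3
    (hFrame : ∀ (X : Scheme.{0}) (σ : X ⟶ P) (S : Set X) (jG : F₉ ⟶ X) (tG : F₉ ⟶ Spec (.of k)) (𝒞 : X.IdealSheafData),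
      Ch X σ S → IsIntegral X → IsLocallyNoetherian X → Scheme.IsRegular X → IsDominant (σ ≫ q) →
      IsPullback jG tG (σ ≫ q) (Spec.map (CommRingCat.ofHom θ)) → jG '' T₉ = S →
      𝒞.comap jG = vanishingIdeal ⟨Z₉, hZ₉⟩ → Flat (𝒞.subschemeι ≫ σ ≫ q) → Scheme.IsRegular 𝒞.subscheme →
      ∀ x ∈ 𝒞.support, ∃ c : Fin 2 → X.presheaf.stalk x, Ideal.span (Set.range c) = stalkIdeal 𝒞 x ∧ IsQuasiRegular c)
    -- RESIDUE (d) = (T-j), owner res-L1-type-o6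
    (hTj : RationalCarrierLift O k θ P q) :
    Tower.Inv₂ O k θ P q Y Ch (DirLift.Ruled O k θ P q Y) F₉ Z₉ hZ₉ F₁₀ υ' F₁₀ (𝟙 F₁₀) (closure (υ' ⁻¹' (T₉ \ Z₉))) (υ' ⁻¹' Z₉)
      (closure (υ' ⁻¹' (K₉ \ Z₉))) :=
  Tower.inv₂_of_inv_curveStep_forget O k θ hθ P q Y hYirr hYcl hPnoeth hPreg Ch hChain hStep (DirLift.Ruled O k θ P q Y) W F₉ β₉ T₉ Z₉
    K₉ b₉ hZ₉ F₁₀ υ' hI hZinf hK₉ hZT hTZ hυ'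
    (fun X σ S jG tG 𝓢 K X₁₀ τ j₁₀ t₁₀ hCh hXint hXnoeth hXreg hdom hsq hTS hCD hCflat hCreg _ hτ hsq₁₀ hcomm => by
      haveI := hXint
      haveI := hXnoeth
      exact DirLift.ruled_curveStep_root hυ' X σ jG tG (𝓢 ⊔ K) X₁₀ τ j₁₀ t₁₀ hXreg hsq hCD hCflat hCreg hτ hsq₁₀ hcomm
        (image_support_subset_not_isGenericPoint_of_chain θ hθ q Y hYsp σ S (hChain _ _ _ hCh) jG tG hsq T₉ hTS (𝓢 ⊔ K) Z₉ hZ₉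
          hCD hTZ)
        (hFrame X σ S jG tG (𝓢 ⊔ K) hCh hXint hXnoeth hXreg hdom hsq hTS hCD hCflat hCreg)
        (fun h₉ => by
          haveI : IsProper σ := (chain_isRegular P Y X σ S (hChain _ _ _ hCh) hPnoeth hPreg).2.2
          exact hTj.hCrat_of_isProper σ (𝓢 ⊔ K) hsq hCD hCflat hCreg h₉))

end Summit.ResolutionOfSingularities.ResolutionOfSingularities.Cruxes.EquisingularLiftNat.Sections

end
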